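import Literature.MathematicalPhysics.QuantumFieldTheory.ConformalBootstrap3D.PointKernelK34v2Data
import Literature.MathematicalPhysics.QuantumFieldTheory.ConformalBootstrap3D.PointKernelParts

/-!
# K34v2 certificate, kernel part file P9: one-cell head segments 101, 102 in level ranges

The head cells whose kernel evaluation exceeds one `decide` are one-cell segments of `hsegsK34v2`; each is
checked by `PCert.hPartSideOK` (side conditions) and `PCert.hPartOK` per level range `[n_lo, n_lo + count)`
against an integer claim, the claims summing to `≥ 0` (`PointKernel.partsOK`); soundness is
`PCert.hParts_sound` (`PointKernelParts`).  The part files `P1, P2, …` are mutually independent (each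
imports only the data file); the ranges of one cell may span several of them, and the per-cell
conclusions `hparts_i` / `hcell_i` of those cells are assembled in `PointKernelK34v2.lean`.
Estimated kernel time 229 s.
-/

set_option maxRecDepth 100000
set_option maxHeartbeats 0

namespace Literature.MathematicalPhysics.QuantumFieldTheory.ConformalBootstrap3D.PointKernelK34v2

open Literature.MathematicalPhysics.QuantumFieldTheory.ConformalBootstrap3D.PointKernel

/-- levels `[32, 45)` of segment 101: partial lower sum `≥` claim. [folklore] -/
theorem part_101_1 : certK34v2.hPartOK (PCert.segAt hsegsK34v2 101) JHK34v2 32 13 (2102968699366344898484283256391005773) = true := by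
  decide +kernel

/-- levels `[45, 51)` of segment 101: partial lower sum `≥` claim. [folklore] -/
theorem part_101_2 : certK34v2.hPartOK (PCert.segAt hsegsK34v2 101) JHK34v2 45 6 (312669630991567353885863460155432584) = true := by
  decide +kernel

/-- one-cell segment 102 (row 4, cell `[1281/256, 2563/512]`, chord, `n_F = 58`,
4 level ranges): side conditions. [folklore] -/
theorem pside_102 : certK34v2.hPartSideOK (PCert.segAt hsegsK34v2 102) JHK34v2 = true := by
  decide +kernel

/-- its level ranges `(n_lo, count, claim)`. [folklore] -/
def parts_102 : List (ℕ × ℕ × ℤ) := [(0, 31, -2797969925298064367667252273063765165), (31, 12, 2164228186299059991591548186567403132), (43, 9, 499537984855059587985289913323533719), (52, 7, 134203754143944788090414173172828314)]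

/-- the ranges tile `[0, n_F]` and the claims sum to `≥ 0`. [folklore] -/
theorem pcov_102 : PointKernel.partsOK 58 parts_102 = true := by
  decide +kernel

/-- levels `[0, 31)` of segment 102: partial lower sum `≥` claim. [folklore] -/
theorem part_102_0 : certK34v2.hPartOK (PCert.segAt hsegsK34v2 102) JHK34v2 0 31 (-2797969925298064367667252273063765165) = true := by
  decide +kernel

/-- levels `[31, 43)` of segment 102: partial lower sum `≥` claim. [folklore] -/
theorem part_102_1 : certK34v2.hPartOK (PCert.segAt hsegsK34v2 102) JHK34v2 31 12 (2164228186299059991591548186567403132) = true := by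
  decide +kernel

end Literature.MathematicalPhysics.QuantumFieldTheory.ConformalBootstrap3D.PointKernelK34v2
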